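/-
Copyright (c) 2026 the pub-hodgecm-mathlib formalisation cell (harness21).  Prover seat hodgecm-mathlib-K2E3-p07 (g0), Track B ∕ K2-LIT
(build stream 29), h413 = `stmt-HodgeConjecture-24833`, line `K2_E3_EllipticInputs`, socket module U4 «Keys», SIGS-TABLE-K2E3 row #7 — the payment
of `K2E3EllipticInputs.U4Keys.sig_K2E3IntertwinerSpaceDimLeOne` TOKEN FOR TOKEN.  2026-09-03.
-/
import Summits.HodgeConjecture.HodgeConjecture.Theorems.F0P2pCmPrincipalSeriesInterface        -- ★ Frobenius, uniqueness form: `intertwiningMap_cmPrincipalSeries_eq_smul`, `isSmooth_cmPrincipalSeries`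
import Summits.HodgeConjecture.HodgeConjecture.Theorems.F0P3U3PrincipalSeriesJacquetFiltrationHolds  -- ★ N1 `U3PrincipalSeriesJacquetFiltration_holds` [Casselman1995 L. 7.1.1 (a)]
import Summits.HodgeConjecture.HodgeConjecture.Theorems.F0P2pEigenlineFunctionals              -- ★ `exists_apply_ne_of_ne`
import Literature.NumberTheory.Automorphic.U3PrincipalSeriesJacquetFiltrationFullUnfold           -- ★ N1 ↔ its body (`U3PrincipalSeriesJacquetFiltration_iff`)
import HarnessLib

/-!
# h413 ∕ Track B «K2-LIT», line `K2_E3_EllipticInputs`, unit U4 «KEYS», file #7: `dim Hom_G(i_G(χ), i_G(wχ)) ≤ 1` FOR A REGULAR CHARACTER `χ`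
# (payment of `Cruxes/H413/Lines/K2_E3_EllipticInputsSigs_U4Keys.lean :: sig_K2E3IntertwinerSpaceDimLeOne`, statement bytes frozen)

Cell `pub/hodgecm-mathlib`, crux H413 = `stmt-HodgeConjecture-24833`, route of record `HCCMUnconditional`; chair K2-lead (g0), dealer K2E3-plan (g0),
EMIT «SKELETON LANDED K2E3» (REQUESTS l.72411), SIGS-TABLE-K2E3 row #7 `sig_K2E3IntertwinerSpaceDimLeOne` (U4-d, M–L) ↦ seat K2E3-p07.
THEOREMS ONLY (no `def`, no `instance`, no `notation`, no named-fact hypothesis, no `sorry`); lane `--supports stmt-HodgeConjecture-24833 --as helper`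
(count-neutral: one U4 brick of the line; it does not move 24833).

THE STATEMENT (bytes of the socket, with the Lines-side `abbrev Pl L := HeightOneSpectrum (𝓞 L⁺)` inlined).  `L` a CM field, `v` a finite place of
`L⁺` NON-SPLIT in `L` (every `w ∣ v` is fixed by complex conjugation), `G = U(Φ₃)(L⁺_v)` with upper-triangular Borel `B = TN`, `χ = (χ₁, χ₂)` a
continuous character of `T ≅ L_v^× × E¹_v` (★ `cmTorusCharPair L v χ₁ χ₂`) which is REGULAR: `χ ≠ wχ = (χ̄₁⁻¹, χ₂)` (★ `cmTorusCharPair L v (conjInvChar σ χ₁) χ₂`).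
Then for all intertwining maps `A, A' : i_G(χ) → i_G(wχ)` (★ `cmPrincipalSeries L 3 v`, Mathlib `Representation.IntertwiningMap`) with `A ≠ 0`
there is `c : ℂ` with `A' x = c • A x` for every `x` — i.e. `dim_ℂ Hom_G(i_G(χ), i_G(wχ)) ≤ 1`.

THE MATHEMATICS ([BernsteinZelevinsky1977, Prop. 1.9 (b), §2.12 Geometrical Lemma, Cor. 2.13 (c), Thm. 2.9]; [Casselman1995, Thm. 3.2.4, §6.4
Thm. 6.4.1, L. 7.1.1 (a)]; [Keys1984, §3 Thm. 2 (Silberger): «the dimension of the commuting algebra …»]).  By Frobenius reciprocity for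
normalised induction, `Hom_G(i_G(χ), i_G(wχ)) ≅ Hom_T(r_B i_G(χ), ℂ_{wχ})` (★ `Representation.frobenius_normalizedInd_holds`, read on the CM
spelling by ★ `F0P2pCmPrincipalSeriesInterface.intertwiningMap_cmPrincipalSeries_eq_smul` — the UNIQUENESS form: proportionality on the Jacquet side
transports to proportionality of `G`-maps).  The normalised Jacquet module `X = r_B i_G(χ)` has a `T`-stable LINE `ℓ` (the `wχ`-eigen-line) modulo
which `T` acts by `χ` (★ N1 `U3PrincipalSeriesJacquetFiltration_holds`, [Casselman1995, L. 7.1.1 (a)], hypothesis-free in the tree; read through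
★ `U3PrincipalSeriesJacquetFiltration_iff`).  LINEAR ALGEBRA (§1, for an arbitrary group `M` acting on `X`): a `M`-map `ψ : X → ℂ_α` that kills a
subspace `ℓ` modulo which `M` acts by `β ≠ α` is zero (on `X` one has `ψ(r(m)x) = α(m)ψ(x)` and `ψ(r(m)x) = β(m)ψ(x)`, so `(α(m₀) − β(m₀))ψ(x) = 0`
with `α(m₀) ≠ β(m₀)`); hence restriction to `ℓ` is INJECTIVE on `Hom_M(X, ℂ_α)`, and when `ℓ` is a line two such maps are proportional as soon
as the first is non-zero.  With `α = wχ`, `β = χ` this is the hypothesis `huniq` of the Frobenius uniqueness form, and the socket follows.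
(The `wχ`-eigen-line clause and `dim X = 2` of N1 are not needed for the bound `≤ 1`; they give `= 1`, which the socket does not ask.)

* §1 `intertwiningMap_character_eq_zero_of_forall_mem` · an `M`-map `X → ℂ_α` killing `ℓ` (`M` acts by `β ≠ α` on `X ⁄ ℓ`) is `0`;
       `intertwiningMap_lineCharacter_eq_smul`          · `Hom_M(X, ℂ_α)` is at most a line when `ℓ` is a line (generic `M`, `X`, `α`, `β`).
* §2 **`intertwinerSpaceDimLeOne`**                      · `sig_K2E3IntertwinerSpaceDimLeOne` TOKEN FOR TOKEN (tie probe
      `example : type_of% @intertwinerSpaceDimLeOne = type_of% @K2E3EllipticInputs.U4Keys.sig_K2E3IntertwinerSpaceDimLeOne := rfl`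
      at home once the socket module is built on stream 29: `K2/K2E3-p07/g0/Probe_K2E3IntertwinerSpaceDimLeOne.lean`).

WHAT IS NOT HERE.  The converse bound `dim ≥ 1` (★ `exists_intertwiningMap_cmPrincipalSeries_ne_zero` + ★ `exists_intertwiningMap_character_of_line`
give it; not asked), `End_G(i_G(χ)) = ℂ` (row #8, `sig_K2E3IntertwinerCompositionScalar`, seat K2E3-p08: the same Frobenius step with the OTHER
linear-algebra lemma ★ `F0P2pEigenlineFunctionals.intertwiningMap_character_eq_smul`), Casselman's criterion (rows #4–#6).

HONEST LABEL.  HC_CM is proved only modulo the 7 printed citations (2 remaining named inputs: hLiu418 = `stmt-HodgeConjecture-24832`, h413 =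
`stmt-HodgeConjecture-24833`) until rung 0 closes; this file moves no counter.

## References
* [BernsteinZelevinsky1977] I. N. Bernstein, A. V. Zelevinsky, *Induced representations of reductive `p`-adic groups. I*, Ann. Sci. ÉNS (4) 10 (1977)
  441–472 — Prop. 1.9 (b) p. 445 (Frobenius reciprocity `Hom(r(π), ρ) = Hom(π, I(ρ))`), §2.12 Geometrical Lemma, Cor. 2.13 (c), Thm. 2.9.
* [Casselman1995] W. Casselman, *Introduction to the theory of admissible representations of `p`-adic reductive groups* (draft 1 May 1995) —
  Thm. 3.2.4 (Frobenius), §6.4 Thm. 6.4.1 pp. 62–64, L. 7.1.1 (a) p. 67.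
* [Keys1984] D. Keys, *Principal series representations of special unitary groups over local fields*, Compositio Math. 51 (1984) — §3 Thms. 1–2
  (Harish-Chandra's commuting-algebra theorem; Silberger's dimension formula).
* [Rogawski1990] J. D. Rogawski, *Automorphic Representations of Unitary Groups in Three Variables*, Ann. of Math. Stud. 123 (1990) — §12.1 p. 171,
  §12.2 p. 173 («`w(χ₁, χ₂) = (χ̄₁⁻¹, χ₂)`»).
-/

set_option autoImplicit false
-- the mandated namespace repeats the single-problem summit's segment (`HodgeConjecture.HodgeConjecture`)
set_option linter.dupNamespace false

noncomputable section

open NumberField IsDedekindDomain MeasureTheory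
open scoped Matrix MatrixGroups NNReal

open Literature.NumberTheory Literature.NumberTheory.Automorphic Literature.NumberTheory.Automorphic.UnitaryGroup
open Literature.NumberTheory.Rogawski1990

namespace Summit.HodgeConjecture.HodgeConjecture.Cruxes.H413.K2E3IntertwinerSpaceDimLeOne

open F0P2pEigenlineFunctionals (exists_apply_ne_of_ne)

/-! ## §1 Linear algebra: `Hom_M(X, ℂ_α)` embeds in the dual of a line `ℓ` when `M` acts by `β ≠ α` on `X ⁄ ℓ` -/

section Line

variable {M : Type*} [Group M] {X : Type*} [AddCommGroup X] [Module ℂ X]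

/-- **An `M`-map `ψ : X → ℂ_α` vanishing on `ℓ` vanishes**, when `M` acts on `X ⁄ ℓ` through a character `β ≠ α` (`r(m)x − β(m)x ∈ ℓ`):
for every `x`, `ψ(r(m)x) = α(m)ψ(x)` (equivariance) and `ψ(r(m)x) = β(m)ψ(x)` (`ψ` kills `ℓ`), so `(α(m₀) − β(m₀))·ψ(x) = 0` at an `m₀` with
`α(m₀) ≠ β(m₀)`.  [cite: Casselman1995, §7.1 L. 7.1.1 (a) p. 67] [cite: BernsteinZelevinsky1977, §2.12, Cor. 2.13 (c)] -/
theorem intertwiningMap_character_eq_zero_of_forall_mem (r : Representation ℂ M X) (α β : M →* ℂˣ) (hne : α ≠ β)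
    (ℓ : Submodule ℂ X) (hq : ∀ m x, r m x - ((β m : ℂˣ) : ℂ) • x ∈ ℓ)
    (ψ : r.IntertwiningMap ((Representation.trivial ℂ M ℂ).twist α)) (h0 : ∀ x ∈ ℓ, ψ x = 0) : ψ = 0 := by
  obtain ⟨m₀, hm₀⟩ := exists_apply_ne_of_ne hne
  refine Representation.IntertwiningMap.ext (LinearMap.ext fun x => ?_)
  rw [Representation.IntertwiningMap.zero_toLinearMap, LinearMap.zero_apply, Representation.IntertwiningMap.toLinearMap_apply]
  -- equivariance: `ψ (r m₀ x) = α m₀ • ψ x`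
  have h1 := Representation.IntertwiningMap.isIntertwining _ _ ψ m₀ x
  simp only [Representation.twist_apply, Representation.trivial_apply, smul_eq_mul] at h1
  -- `ψ` kills `r m₀ x - β m₀ • x ∈ ℓ`
  have h2 : ψ (r m₀ x) = ((β m₀ : ℂˣ) : ℂ) * ψ x := by
    have h := h0 _ (hq m₀ x)
    rwa [map_sub, map_smul, smul_eq_mul, sub_eq_zero] at h
  have h3 : (((α m₀ : ℂˣ) : ℂ) - ((β m₀ : ℂˣ) : ℂ)) * ψ x = 0 := by rw [sub_mul, ← h1, h2, sub_self]
  exact (mul_eq_zero.1 h3).resolve_left (sub_ne_zero.2 hm₀)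

/-- **`Hom_M(X, ℂ_α)` is at most a line.**  If `ℓ ≤ X` is a LINE modulo which `M` acts through `β ≠ α`, then any two `M`-maps
`ψ₁, ψ₂ : X → ℂ_α` with `ψ₁ ≠ 0` are proportional: restriction to `ℓ` is injective on `Hom_M(X, ℂ_α)`
(`intertwiningMap_character_eq_zero_of_forall_mem`) and `Hom_ℂ(ℓ, ℂ)` is a line.  Applied to `X = r_B i_G(χ)` (its `wχ`-line `ℓ`, quotient
character `χ`) with `α = wχ`, `β = χ` this is `dim Hom_T(r_B i_G(χ), ℂ_{wχ}) ≤ 1`.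
[cite: Casselman1995, §7.1 L. 7.1.1 (a) p. 67; §6.4 Thm. 6.4.1] [cite: BernsteinZelevinsky1977, §2.12, Cor. 2.13 (c), Thm. 2.9] -/
theorem intertwiningMap_lineCharacter_eq_smul (r : Representation ℂ M X) (α β : M →* ℂˣ) (hne : α ≠ β)
    (ℓ : Submodule ℂ X) (hℓ1 : Module.finrank ℂ ↥ℓ = 1) (hq : ∀ m x, r m x - ((β m : ℂˣ) : ℂ) • x ∈ ℓ)
    (ψ₁ ψ₂ : r.IntertwiningMap ((Representation.trivial ℂ M ℂ).twist α)) (h₁ : ψ₁ ≠ 0) :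
    ∃ c : ℂ, ψ₂ = c • ψ₁ := by
  -- a generator `x₀` of the line `ℓ`
  haveI : Module.Finite ℂ ↥ℓ := Module.finite_of_finrank_eq_succ hℓ1
  obtain ⟨x₀, hx₀, hgen⟩ := finrank_eq_one_iff'.1 hℓ1
  -- `ψ₁ x₀ ≠ 0`, else `ψ₁` kills `ℓ` and vanishes
  have h₁x : ψ₁ (x₀ : X) ≠ 0 := by
    intro h0
    apply h₁
    refine intertwiningMap_character_eq_zero_of_forall_mem r α β hne ℓ hq ψ₁ fun x hx => ?_
    obtain ⟨d, hd⟩ := hgen ⟨x, hx⟩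
    have hx' : (x : X) = d • (x₀ : X) := by rw [← Submodule.coe_smul, hd]
    rw [hx', map_smul, h0, smul_zero]
  -- the ratio
  refine ⟨ψ₂ (x₀ : X) / ψ₁ (x₀ : X), ?_⟩
  -- `ψ₂ - c • ψ₁` kills `ℓ`, hence vanishes
  have hδ : ψ₂ - (ψ₂ (x₀ : X) / ψ₁ (x₀ : X)) • ψ₁ = 0 := by
    refine intertwiningMap_character_eq_zero_of_forall_mem r α β hne ℓ hq _ fun x hx => ?_
    obtain ⟨d, hd⟩ := hgen ⟨x, hx⟩
    have hx' : (x : X) = d • (x₀ : X) := by rw [← Submodule.coe_smul, hd]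
    rw [hx', map_smul]
    change d • ((ψ₂ : X → ℂ) - (ψ₂ (x₀ : X) / ψ₁ (x₀ : X)) • (ψ₁ : X → ℂ)) (x₀ : X) = 0
    rw [Pi.sub_apply, Pi.smul_apply, smul_eq_mul, smul_eq_mul, div_mul_cancel₀ _ h₁x, sub_self, mul_zero]
  exact (sub_eq_zero.1 hδ)

end Line

/-! ## §2 The socket: `dim Hom_G(i_G(χ), i_G(wχ)) ≤ 1` for `G = U(Φ₃)(L⁺_v)`, `v` non-split, `χ` regular -/

set_option synthInstance.maxHeartbeats 400000 in  -- HB: as the socket module (instance paths on the CM carrier `∏_{w ∣ v} L_w`)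
set_option maxHeartbeats 3200000 in  -- HB (measured 2026-09-03, this file∕this decl only): the socket STATEMENT is budgeted 1 600 000 in its own module `K2_E3_EllipticInputsSigs_U4Keys`; statement + proof here is RED at 1 600 000 and GREEN at 2 400 000 (cost = matching the two ≈10⁷-node principal-series carriers against ★ N1 and the ★ Frobenius interface; no `rw`∕`simp` on the socket goal); 3 200 000 = 2× the socket budget for head-room
/-- **`dim Hom_G(i_G(χ), i_G(wχ)) ≤ 1` FOR REGULAR `χ`** — the socket `sig_K2E3IntertwinerSpaceDimLeOne` TOKEN FOR TOKEN: at a non-split finite place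
`v` of `L⁺`, for continuous `χ₁`, `χ₂` with `χ = (χ₁, χ₂) ≠ wχ = (χ̄₁⁻¹, χ₂)`, any two intertwining maps `A, A' : i_G(χ) → i_G(wχ)` with `A ≠ 0`
satisfy `A' = c • A`.  Frobenius (uniqueness form, ★ `intertwiningMap_cmPrincipalSeries_eq_smul` at `π = i_G(χ)`, ★ `isSmooth_cmPrincipalSeries`)
reduces it to the Jacquet side, where ★ N1 (`U3PrincipalSeriesJacquetFiltration_holds`, through ★ `…_iff`) supplies the `wχ`-line `ℓ ≤ r_B i_G(χ)`
with quotient character `χ`, and §1 `intertwiningMap_lineCharacter_eq_smul` (with `α = wχ`, `β = χ`, `α ≠ β` = regularity) concludes.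
(Bruhat ∕ Bernstein–Zelevinsky: the Hom-space between principal series with regular `W`-conjugate characters is a line spanned by the
standard intertwining operator; only `≤ 1` is asked and proved here.)
[cite: BernsteinZelevinsky1977, Prop. 1.9 (b) p. 445; Thm. 2.9; §2.12, Cor. 2.13 (c)] [cite: Casselman1995, Thm. 3.2.4; §6.4 Thm. 6.4.1; L. 7.1.1 (a) p. 67]
[cite: Keys1984, §3 Thms. 1–2] [cite: Rogawski1990, §12.2 p. 173] -/
theorem intertwinerSpaceDimLeOne :
  ∀ (L : Type) [Field L] [NumberField L] [IsCMField L] (v : HeightOneSpectrum (𝓞 ↥(maximalRealSubfield L))),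
    (∀ w : PlacesOver L v, IsCMField.complexConj L • w.1 = w.1) →
    ∀ (χ₁ : (UnitaryGroup.LocalRing L v)ˣ →* ℂˣ) (χ₂ : ↥(normOneUnits (conjLocal L (IsCMField.complexConj L) v)) →* ℂˣ), Continuous (fun x => ((χ₁ x : ℂˣ) : ℂ)) → Continuous (fun x => ((χ₂ x : ℂˣ) : ℂ)) → UnitaryGroup.cmTorusCharPair L v χ₁ χ₂ ≠ UnitaryGroup.cmTorusCharPair L v (UnitaryGroup.conjInvChar (conjLocal L (IsCMField.complexConj L) v) χ₁) χ₂ →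
      ∀ (A A' : (UnitaryGroup.cmPrincipalSeries L 3 v (UnitaryGroup.cmTorusCharPair L v χ₁ χ₂)).IntertwiningMap (UnitaryGroup.cmPrincipalSeries L 3 v (UnitaryGroup.cmTorusCharPair L v (UnitaryGroup.conjInvChar (conjLocal L (IsCMField.complexConj L) v) χ₁) χ₂))), A ≠ 0 → ∃ c : ℂ, ∀ x, A'.toLinearMap x = c • A.toLinearMap x := by
  intro L _ _ _ v hns χ₁ χ₂ h₁ h₂ hreg A A' hA
  haveI := locallyCompactSpace_cmBorelU L 3 v
  -- ★ N1: the normalised Jacquet module of `i_G(χ)` has a line `ℓ` modulo which `T` acts by `χ` (its `wχ`-action and `dim = 2` are not needed)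
  have hN1 := (UnitaryGroup.U3PrincipalSeriesJacquetFiltration_iff L).1
    (F0P3U3PrincipalSeriesJacquetFiltrationHolds.U3PrincipalSeriesJacquetFiltration_holds L) v hns χ₁ χ₂ h₁ h₂
  obtain ⟨ℓ, hℓ1, _, hquot⟩ := hN1.2.2
  -- Frobenius, uniqueness form, fed with §1 on the Jacquet side (`α = wχ`, `β = χ`)
  obtain ⟨c, hc⟩ := F0P2pCmPrincipalSeriesInterface.intertwiningMap_cmPrincipalSeries_eq_smul L v
    (cmTorusCharPair L v (conjInvChar (conjLocal L (IsCMField.complexConj L) v) χ₁) χ₂)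
    (cmPrincipalSeries L 3 v (cmTorusCharPair L v χ₁ χ₂)) (F0P2pCmPrincipalSeriesInterface.isSmooth_cmPrincipalSeries L v _)
    (fun ψ₁ ψ₂ hψ₁ => intertwiningMap_lineCharacter_eq_smul
      (M := ↥(cmBorelTriple L 3 v).M)
      ((cmPrincipalSeries L 3 v (cmTorusCharPair L v χ₁ χ₂)).normalizedJacquet (cmBorelTriple L 3 v))
      (cmTorusCharPair L v (conjInvChar (conjLocal L (IsCMField.complexConj L) v) χ₁) χ₂) (cmTorusCharPair L v χ₁ χ₂)
      hreg.symm ℓ hℓ1 hquot ψ₁ ψ₂ hψ₁)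
    A A' hA
  subst hc
  exact ⟨c, fun x => rfl⟩

end Summit.HodgeConjecture.HodgeConjecture.Cruxes.H413.K2E3IntertwinerSpaceDimLeOne

end
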